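import Literature.NumberTheory.LFunctions.TrilinearKloostermanFractionsDiagPhase
import Literature.NumberTheory.LFunctions.TrilinearKloostermanFractionsTwistedSharp
import HarnessLib

/-!
# Trilinear forms with Kloosterman fractions: one `m`-sum of the diagonal (Bettin–Chandee §3, (3.3))

Topic `NumberTheory/LFunctions`.  S. Bettin, V. Chandee, *Trilinear forms with Kloosterman
fractions*, Adv. Math. 328 (2018), §3: on the diagonal `ℓ₁n₁ = ℓ₂n₂` the `m`-sum is
"`∑_{m ∈ 𝓜, (m, bℓ₁ℓ₂n₁n₂)=1} e(ϑ(a₁ℓ₁ − a₂ℓ₂)m̄/(bℓ₁n₁))` ≪ `(bLN)^{1/2+ε} + (a₁ℓ₁−a₂ℓ₂, bn₁ℓ₁) M^{1+ε}/(bLN)`"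
((3.3), "since `(ϑ, bℓ₁n₂) = 1`"), while "the terms with `a₁ℓ₁ = a₂ℓ₂`" are bounded trivially.
This file PROVES the corresponding statement for the general-`A`, TWISTED coefficients
`c_m(n) = γ_n ∑_a ν_a e(ϑ a m̄^{(bn)}/(bn) + η a/(m bn))` of `TrilinearKloostermanFractionsFrom51.lean`
(hypothesis `hD`), one pair `(a₁, a₂)` at a time:

* `BC_diagE_mul_conj` — for `ℓ₁n₁ = ℓ₂n₂` and `(m, bℓ₁n₁) = 1` the product of the two full phases is
  `e(ϑc m̄^{(q)}/q) e(θ/m)`, `q = bℓ₁n₁`, `c = a₁ℓ₁ − a₂ℓ₂`, `θ = ηc/q` (`BC_phase_combine2`,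
  `BC_twist_combine`);
* **`BC_diag_msum_le`** — the `m`-sum over `M < m ≤ 2M`, `(m,b) = 1`, `(ℓ₂n₂, m) = 1` of that
  product has norm `≤ 2M` if `c = 0`, and, if `c ≠ 0` and `(ϑ, q) = 1`,
  `≤ τ(q) ((2M+1)(c,q)/q + τ(q) √q (1 + log q)) (1 + 2π(|η||c|/q)/M)`
  (the sharp appendix Lemma 1 with the twist, `BC_twisted_msum_sharp_le`).

No new named facts (D-0026).

## References

* S. Bettin, V. Chandee, Adv. Math. 328 (2018) 1234–1262 (arXiv:1502.00769), §3 ((3.3) and the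
  preceding displays), Remark 2, Appendix Lemma 1. [BettinChandee2018]
-/

noncomputable section

open Finset Real

namespace Literature.NumberTheory.LFunctions

/-- Splitting the full phase `e(ϑ a m̄/(bn) + η a/(m bn)) = e(ϑ a m̄/(bn)) · e(η a/(m bn))`, with the
Kloosterman part written with the integer numerator `ϑa`. [folklore] -/
theorem BC_diagE_split (ϑ : ℤ) (η : ℝ) (a b n m : ℕ) :
    Complex.exp (2 * Real.pi * Complex.I *
        ((ϑ : ℂ) * (a : ℂ) * ((((m : ZMod (b * n))⁻¹).val : ℕ) : ℂ) / ((b * n : ℕ) : ℂ) +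
          (η : ℂ) * (a : ℂ) / ((m : ℂ) * ((b * n : ℕ) : ℂ)))) =
      Complex.exp (2 * Real.pi * Complex.I *
        (((ϑ * a : ℤ) : ℂ) * ((((m : ZMod (b * n))⁻¹).val : ℕ) : ℂ) / ((b * n : ℕ) : ℂ))) *
      Complex.exp (2 * Real.pi * Complex.I * ((η : ℂ) * (a : ℂ) / ((m : ℂ) * ((b * n : ℕ) : ℂ)))) := by
  rw [← Complex.exp_add]
  congr 1
  push_cast
  ring

/-- **The product of the two full phases on the diagonal**: for `ℓ₁n₁ = ℓ₂n₂`, `b, ℓ₁, n₁, n₂, m ≥ 1`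
and `(m, bℓ₁n₁) = 1`,
`e(ϑa₁m̄/(bn₁) + ηa₁/(m bn₁)) · conj e(ϑa₂m̄/(bn₂) + ηa₂/(m bn₂)) = e(ϑc m̄^{(q)}/q) · e(θ/m)` with
`q = bℓ₁n₁`, `c = a₁ℓ₁ − a₂ℓ₂`, `θ = ηc/q` (Bettin–Chandee §3 second display, and Remark 2).
[cite: BettinChandee2018, §3] -/
theorem BC_diagE_mul_conj (ϑ : ℤ) (η : ℝ) (a₁ a₂ : ℕ) {b ℓ₁ n₁ ℓ₂ n₂ m : ℕ} (hb : 0 < b)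
    (hℓ₁ : 0 < ℓ₁) (hn₁ : 0 < n₁) (hn₂ : 0 < n₂) (hm : 0 < m) (hN : ℓ₁ * n₁ = ℓ₂ * n₂)
    (hcop : m.Coprime (b * (ℓ₁ * n₁))) :
    Complex.exp (2 * Real.pi * Complex.I *
        ((ϑ : ℂ) * (a₁ : ℂ) * ((((m : ZMod (b * n₁))⁻¹).val : ℕ) : ℂ) / ((b * n₁ : ℕ) : ℂ) +
          (η : ℂ) * (a₁ : ℂ) / ((m : ℂ) * ((b * n₁ : ℕ) : ℂ)))) *
      (starRingEnd ℂ) (Complex.exp (2 * Real.pi * Complex.I *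
        ((ϑ : ℂ) * (a₂ : ℂ) * ((((m : ZMod (b * n₂))⁻¹).val : ℕ) : ℂ) / ((b * n₂ : ℕ) : ℂ) +
          (η : ℂ) * (a₂ : ℂ) / ((m : ℂ) * ((b * n₂ : ℕ) : ℂ))))) =
      Complex.exp (2 * Real.pi * Complex.I *
        (((ϑ * ((a₁ * ℓ₁ : ℕ) - (a₂ * ℓ₂ : ℕ) : ℤ) : ℤ) : ℂ) *
          ((((m : ZMod (b * (ℓ₁ * n₁)))⁻¹).val : ℕ) : ℂ) / ((b * (ℓ₁ * n₁) : ℕ) : ℂ))) *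
      Complex.exp (2 * Real.pi * Complex.I *
        (((η * (((a₁ * ℓ₁ : ℕ) : ℝ) - ((a₂ * ℓ₂ : ℕ) : ℝ)) / ((b * (ℓ₁ * n₁) : ℕ) : ℝ) : ℝ) : ℂ) /
          (m : ℂ))) := by
  rw [BC_diagE_split ϑ η a₁ b n₁ m, BC_diagE_split ϑ η a₂ b n₂ m, map_mul]
  have hK := BC_phase_combine2 (ϑ * a₁) (ϑ * a₂) hb hℓ₁ hn₁ hn₂ hN hcop
  have hT := BC_twist_combine η a₁ a₂ hb hℓ₁ hn₁ hn₂ hm hN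
  have hnum : (ϑ * a₁ * ℓ₁ - ϑ * a₂ * ℓ₂ : ℤ) = ϑ * ((a₁ * ℓ₁ : ℕ) - (a₂ * ℓ₂ : ℕ) : ℤ) := by
    push_cast; ring
  rw [hnum] at hK
  calc _ = (Complex.exp (2 * Real.pi * Complex.I *
          (((ϑ * a₁ : ℤ) : ℂ) * ((((m : ZMod (b * n₁))⁻¹).val : ℕ) : ℂ) / ((b * n₁ : ℕ) : ℂ))) *
        (starRingEnd ℂ) (Complex.exp (2 * Real.pi * Complex.I *
          (((ϑ * a₂ : ℤ) : ℂ) * ((((m : ZMod (b * n₂))⁻¹).val : ℕ) : ℂ) / ((b * n₂ : ℕ) : ℂ))))) *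
        (Complex.exp (2 * Real.pi * Complex.I * ((η : ℂ) * (a₁ : ℂ) / ((m : ℂ) * ((b * n₁ : ℕ) : ℂ)))) *
          (starRingEnd ℂ) (Complex.exp (2 * Real.pi * Complex.I *
            ((η : ℂ) * (a₂ : ℂ) / ((m : ℂ) * ((b * n₂ : ℕ) : ℂ)))))) := by ring
    _ = _ := by rw [hK, hT]

/-- **One `m`-sum of the diagonal** ((3.3) of the source with the twist of Remark 2, sharp form of
Lemma 1; and the trivial bound when `a₁ℓ₁ = a₂ℓ₂`): for `ℓ₁n₁ = ℓ₂n₂`, `b, ℓ₁, n₁, n₂ ≥ 1`,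
`M ≥ 1/2`, with `q = bℓ₁n₁`, `c = a₁ℓ₁ − a₂ℓ₂`, the sum over `M < m ≤ 2M`, `(m,b) = 1`,
`(ℓ₂n₂, m) = 1` of `e(⋯a₁⋯n₁⋯) conj e(⋯a₂⋯n₂⋯)` has norm `≤ 2M` if `c = 0`, and, if `c ≠ 0` and
`(ϑ, q) = 1`, norm `≤ τ(q) ((2M+1)(c,q)/q + τ(q)√q(1+log q)) (1 + 2π(|η||c|/q)/M)`.
[cite: BettinChandee2018, §3 (3.3)] -/
theorem BC_diag_msum_le (ϑ : ℤ) (η : ℝ) (a₁ a₂ : ℕ) {b ℓ₁ n₁ ℓ₂ n₂ : ℕ} (hb : 0 < b)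
    (hℓ₁ : 0 < ℓ₁) (hn₁ : 0 < n₁) (hn₂ : 0 < n₂) (hN : ℓ₁ * n₁ = ℓ₂ * n₂) {M : ℝ} (hM : 1 / 2 ≤ M) :
    let q : ℕ := b * (ℓ₁ * n₁)
    let c : ℤ := ((a₁ * ℓ₁ : ℕ) : ℤ) - ((a₂ * ℓ₂ : ℕ) : ℤ)
    let S : ℂ := ∑ m ∈ (Ioc ⌊M⌋₊ ⌊2 * M⌋₊).filter (fun m => m.Coprime b),
      (if (ℓ₂ * n₂).Coprime m then
        Complex.exp (2 * Real.pi * Complex.I *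
            ((ϑ : ℂ) * (a₁ : ℂ) * ((((m : ZMod (b * n₁))⁻¹).val : ℕ) : ℂ) / ((b * n₁ : ℕ) : ℂ) +
              (η : ℂ) * (a₁ : ℂ) / ((m : ℂ) * ((b * n₁ : ℕ) : ℂ)))) *
          (starRingEnd ℂ) (Complex.exp (2 * Real.pi * Complex.I *
            ((ϑ : ℂ) * (a₂ : ℂ) * ((((m : ZMod (b * n₂))⁻¹).val : ℕ) : ℂ) / ((b * n₂ : ℕ) : ℂ) +
              (η : ℂ) * (a₂ : ℂ) / ((m : ℂ) * ((b * n₂ : ℕ) : ℂ)))))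
        else 0)
    (c = 0 → ‖S‖ ≤ 2 * M) ∧
    (c ≠ 0 → (ϑ.natAbs).Coprime q →
      ‖S‖ ≤ (Nat.divisors q).card * ((2 * M + 1) * (Int.gcd c q) / q +
        (Nat.divisors q).card * Real.sqrt q * (1 + Real.log q)) *
        (1 + 2 * Real.pi * (|η| * |(c : ℝ)| / q) / M)) := by
  intro q c S
  have hM0 : 0 < M := by linarith
  have hq0 : 0 < q := Nat.mul_pos hb (Nat.mul_pos hℓ₁ hn₁)
  have hqeq : q = b * (ℓ₂ * n₂) := by show b * (ℓ₁ * n₁) = b * (ℓ₂ * n₂); rw [hN]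
  set θ : ℝ := η * (((a₁ * ℓ₁ : ℕ) : ℝ) - ((a₂ * ℓ₂ : ℕ) : ℝ)) / ((b * (ℓ₁ * n₁) : ℕ) : ℝ) with hθ
  -- rewrite the sum as the twisted incomplete Kloosterman sum to modulus `q`
  have hS : S = ∑ m ∈ (Ioc ⌊M⌋₊ ⌊2 * M⌋₊).filter (fun m => m.Coprime q),
      Complex.exp (2 * Real.pi * Complex.I *
          (((ϑ * c : ℤ) : ℂ) * ((((m : ZMod q)⁻¹).val : ℕ) : ℂ) / (q : ℂ))) *
        Complex.exp (2 * Real.pi * Complex.I * ((θ : ℂ) / (m : ℂ))) := by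
    show (∑ m ∈ (Ioc ⌊M⌋₊ ⌊2 * M⌋₊).filter (fun m => m.Coprime b), _) = _
    rw [Finset.sum_filter, Finset.sum_filter]
    refine Finset.sum_congr rfl fun m hm => ?_
    have hm0 : 0 < m := by have := (Finset.mem_Ioc.mp hm).1; omega
    by_cases hmb : m.Coprime b
    · rw [if_pos hmb]
      by_cases hml : (ℓ₂ * n₂).Coprime m
      · have hmq : m.Coprime q := by
          rw [hqeq]; exact Nat.Coprime.mul_right hmb hml.symm
        rw [if_pos hml, if_pos hmq]
        have hcop' : m.Coprime (b * (ℓ₁ * n₁)) := hmq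
        rw [BC_diagE_mul_conj ϑ η a₁ a₂ hb hℓ₁ hn₁ hn₂ hm0 hN hcop']
      · have hmq : ¬ m.Coprime q := by
          intro h; apply hml
          rw [hqeq] at h
          exact (Nat.Coprime.coprime_mul_left_right h).symm
        rw [if_neg hml, if_neg hmq]
    · have hmq : ¬ m.Coprime q := by
        intro h; apply hmb
        exact Nat.Coprime.coprime_mul_right_right (k := ℓ₁ * n₁) h
      rw [if_neg hmb, if_neg hmq]
  constructor
  · -- `c = 0`: every term has norm `≤ 1`
    intro hc0
    rw [hS]
    have hcard : ((((Ioc ⌊M⌋₊ ⌊2 * M⌋₊).filter (fun m => m.Coprime q)).card : ℕ) : ℝ) ≤ 2 * M := by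
      calc ((((Ioc ⌊M⌋₊ ⌊2 * M⌋₊).filter (fun m => m.Coprime q)).card : ℕ) : ℝ)
          ≤ ((Ioc ⌊M⌋₊ ⌊2 * M⌋₊).card : ℝ) := by exact_mod_cast Finset.card_filter_le _ _
        _ = ((⌊2 * M⌋₊ - ⌊M⌋₊ : ℕ) : ℝ) := by rw [Nat.card_Ioc]
        _ ≤ (⌊2 * M⌋₊ : ℝ) := by exact_mod_cast Nat.sub_le _ _
        _ ≤ 2 * M := Nat.floor_le (by linarith)
    refine (norm_sum_le _ _).trans ?_
    refine le_trans (Finset.sum_le_sum (g := fun _ => (1 : ℝ)) fun m _ => ?_) ?_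
    · rw [norm_mul]
      have h1 : ‖Complex.exp (2 * Real.pi * Complex.I *
          (((ϑ * c : ℤ) : ℂ) * ((((m : ZMod q)⁻¹).val : ℕ) : ℂ) / (q : ℂ)))‖ = 1 := by
        have : 2 * (Real.pi : ℂ) * Complex.I *
            (((ϑ * c : ℤ) : ℂ) * ((((m : ZMod q)⁻¹).val : ℕ) : ℂ) / (q : ℂ)) =
            ((2 * Real.pi * (((ϑ * c : ℤ) : ℝ) * ((((m : ZMod q)⁻¹).val : ℕ) : ℝ) / (q : ℝ)) : ℝ) : ℂ) *
              Complex.I := by push_cast; ring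
        rw [this, Complex.norm_exp_ofReal_mul_I]
      have h2 : ‖Complex.exp (2 * Real.pi * Complex.I * ((θ : ℂ) / (m : ℂ)))‖ = 1 := by
        have : 2 * (Real.pi : ℂ) * Complex.I * ((θ : ℂ) / (m : ℂ)) =
            ((2 * Real.pi * (θ / m) : ℝ) : ℂ) * Complex.I := by push_cast; ring
        rw [this, Complex.norm_exp_ofReal_mul_I]
      rw [h1, h2, mul_one]
    · rw [Finset.sum_const, nsmul_eq_mul, mul_one]
      exact hcard
  · -- `c ≠ 0`: the sharp twisted bound
    intro hc hϑq
    rw [hS]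
    have h := BC_twisted_msum_sharp_le hq0 (ϑ * c) θ (M₁ := (⌊M⌋₊ : ℤ)) (M₂ := (⌊2 * M⌋₊ : ℤ))
      (by positivity) (by
        have : ⌊M⌋₊ ≤ ⌊2 * M⌋₊ := Nat.floor_le_floor (by linarith)
        exact_mod_cast this)
    -- convert the integer-indexed sum to the natural-number one
    have hsum : ∑ x ∈ (Finset.Ioc (⌊M⌋₊ : ℤ) (⌊2 * M⌋₊ : ℤ)).filter (fun x : ℤ => Int.gcd x q = 1),
        Complex.exp (2 * Real.pi * Complex.I *
          (((ϑ * c : ℤ) : ℂ) * ((((x : ZMod q)⁻¹).val : ℕ) : ℂ) / (q : ℂ))) *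
        Complex.exp (2 * Real.pi * Complex.I * ((θ : ℂ) / (x : ℂ))) =
      ∑ m ∈ (Ioc ⌊M⌋₊ ⌊2 * M⌋₊).filter (fun m => m.Coprime q),
        Complex.exp (2 * Real.pi * Complex.I *
          (((ϑ * c : ℤ) : ℂ) * ((((m : ZMod q)⁻¹).val : ℕ) : ℂ) / (q : ℂ))) *
        Complex.exp (2 * Real.pi * Complex.I * ((θ : ℂ) / (m : ℂ))) := by
      refine Finset.sum_nbij' (fun y => y.toNat) (fun m => (m : ℤ)) ?_ ?_ ?_ ?_ ?_
      · intro y hy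
        simp only [Finset.mem_filter, Finset.mem_Ioc] at hy ⊢
        obtain ⟨⟨h1, h2⟩, h3⟩ := hy
        refine ⟨⟨by omega, by omega⟩, ?_⟩
        rw [Nat.Coprime, ← h3, Int.gcd_eq_natAbs, Int.natAbs_natCast]
        congr 1; omega
      · intro m hm
        simp only [Finset.mem_filter, Finset.mem_Ioc] at hm ⊢
        obtain ⟨⟨h1, h2⟩, h3⟩ := hm
        refine ⟨⟨by omega, by omega⟩, ?_⟩
        rw [Int.gcd_eq_natAbs, Int.natAbs_natCast, Int.natAbs_natCast]
        exact h3
      · intro y hy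
        simp only [Finset.mem_filter, Finset.mem_Ioc] at hy
        exact Int.toNat_of_nonneg (by omega)
      · intro m _; simp
      · intro y hy
        simp only [Finset.mem_filter, Finset.mem_Ioc] at hy
        have hy0 : 0 ≤ y := by omega
        have hc' : ((y.toNat : ℕ) : ℤ) = y := Int.toNat_of_nonneg hy0
        have hz : ((y.toNat : ℕ) : ZMod q) = ((y : ℤ) : ZMod q) := by rw [← Int.cast_natCast, hc']
        have hcC : ((y.toNat : ℕ) : ℂ) = ((y : ℤ) : ℂ) := by exact_mod_cast hc'
        rw [hz, hcC]
    rw [hsum] at h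
    refine h.trans ?_
    -- simplify: `(ϑc, q) = (c, q)`, `q' = q/(c,q)`, `τ(q') ≤ τ(q)`, `q' ≤ q`, `⌊2M⌋-⌊M⌋+1 ≤ 2M+1`,
    -- `⌊M⌋ + 1 ≥ M`
    have hgcd : Int.gcd (ϑ * c) q = Int.gcd c q := by
      rw [Int.gcd_eq_natAbs, Int.natAbs_mul, Int.natAbs_natCast, Int.gcd_eq_natAbs, Int.natAbs_natCast]
      exact Nat.Coprime.gcd_mul_left_cancel _ hϑq
    rw [hgcd]
    set g : ℕ := Int.gcd c q with hg
    have hg0 : 0 < g := by rw [hg]; exact Int.gcd_pos_of_ne_zero_left _ hc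
    have hgq : g ∣ q := by rw [hg]; exact_mod_cast Int.gcd_dvd_right c q
    set q' : ℕ := q / g with hq'
    have hq'0 : 0 < q' := Nat.div_pos (Nat.le_of_dvd hq0 hgq) hg0
    have hq'q : q' ∣ q := Nat.div_dvd_of_dvd hgq
    have hq'le : q' ≤ q := Nat.div_le_self _ _
    have hqr : (0 : ℝ) < q := by exact_mod_cast hq0
    have hq'r : (0 : ℝ) < q' := by exact_mod_cast hq'0
    have hτ : ((Nat.divisors q').card : ℝ) ≤ (Nat.divisors q).card := by
      exact_mod_cast Finset.card_le_card (Nat.divisors_subset_of_dvd hq0.ne' hq'q)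
    have hsqrt : Real.sqrt (q' : ℝ) ≤ Real.sqrt (q : ℝ) := Real.sqrt_le_sqrt (by exact_mod_cast hq'le)
    have hlogle : 1 + Real.log (q' : ℝ) ≤ 1 + Real.log (q : ℝ) := by
      have := Real.log_le_log hq'r (show (q' : ℝ) ≤ q by exact_mod_cast hq'le); linarith
    have hlog0 : 0 ≤ 1 + Real.log (q' : ℝ) := by
      have := Real.log_nonneg (show (1 : ℝ) ≤ q' by exact_mod_cast hq'0); linarith
    have hinv : 1 / (q' : ℝ) = (g : ℝ) / q := by
      have hmul : (q' : ℝ) * g = q := by exact_mod_cast Nat.div_mul_cancel hgq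
      field_simp; linarith
    have hlen : (((⌊2 * M⌋₊ : ℤ) - (⌊M⌋₊ : ℤ) : ℤ) : ℝ) + 1 ≤ 2 * M + 1 := by
      push_cast
      have h1 : ((⌊2 * M⌋₊ : ℕ) : ℝ) ≤ 2 * M := Nat.floor_le (by linarith)
      have h2 : (0 : ℝ) ≤ ((⌊M⌋₊ : ℕ) : ℝ) := Nat.cast_nonneg _
      linarith
    have hM1 : M ≤ ((⌊M⌋₊ : ℤ) : ℝ) + 1 := by
      have := Nat.lt_floor_add_one M; push_cast; exact_mod_cast this.le
    have htwist : 1 + 2 * Real.pi * |θ| / (((⌊M⌋₊ : ℤ) : ℝ) + 1) ≤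
        1 + 2 * Real.pi * (|η| * |(c : ℝ)| / q) / M := by
      have hθc : θ = η * (c : ℝ) / (q : ℝ) := by
        rw [hθ]
        show _ = η * (((((a₁ * ℓ₁ : ℕ) : ℤ) - ((a₂ * ℓ₂ : ℕ) : ℤ) : ℤ)) : ℝ) / ((b * (ℓ₁ * n₁) : ℕ) : ℝ)
        push_cast; ring
      have hθabs : |θ| = |η| * |(c : ℝ)| / q := by
        rw [hθc, abs_div, abs_mul, abs_of_pos hqr]
      rw [hθabs]
      have hnum : 0 ≤ 2 * Real.pi * (|η| * |(c : ℝ)| / q) := by positivity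
      have := div_le_div_of_nonneg_left hnum hM0 hM1
      linarith
    have htw0 : 0 ≤ 1 + 2 * Real.pi * |θ| / (((⌊M⌋₊ : ℤ) : ℝ) + 1) := by positivity
    have hτ0 : (0 : ℝ) ≤ (Nat.divisors q).card := Nat.cast_nonneg _
    calc (Nat.divisors q).card *
          (((((⌊2 * M⌋₊ : ℤ) - (⌊M⌋₊ : ℤ) : ℤ) : ℝ) + 1) / (q' : ℝ) +
            (Nat.divisors q').card * Real.sqrt (q' : ℝ) * (1 + Real.log (q' : ℝ))) *
          (1 + 2 * Real.pi * |θ| / (((⌊M⌋₊ : ℤ) : ℝ) + 1))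
        ≤ (Nat.divisors q).card * ((2 * M + 1) * (g : ℝ) / q +
            (Nat.divisors q).card * Real.sqrt (q : ℝ) * (1 + Real.log (q : ℝ))) *
          (1 + 2 * Real.pi * (|η| * |(c : ℝ)| / q) / M) := by
          have hfirst : ((((⌊2 * M⌋₊ : ℤ) - (⌊M⌋₊ : ℤ) : ℤ) : ℝ) + 1) / (q' : ℝ) ≤
              (2 * M + 1) * (g : ℝ) / q := by
            have e : ((((⌊2 * M⌋₊ : ℤ) - (⌊M⌋₊ : ℤ) : ℤ) : ℝ) + 1) / (q' : ℝ) =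
                ((((⌊2 * M⌋₊ : ℤ) - (⌊M⌋₊ : ℤ) : ℤ) : ℝ) + 1) * ((g : ℝ) / q) := by
              rw [← hinv]; ring
            rw [e, mul_div_assoc]
            exact mul_le_mul_of_nonneg_right hlen (by positivity)
          have hsecond : (Nat.divisors q').card * Real.sqrt (q' : ℝ) * (1 + Real.log (q' : ℝ)) ≤
              (Nat.divisors q).card * Real.sqrt (q : ℝ) * (1 + Real.log (q : ℝ)) := by
            gcongr
          have hsum0 : 0 ≤ (2 * M + 1) * (g : ℝ) / q +
              (Nat.divisors q).card * Real.sqrt (q : ℝ) * (1 + Real.log (q : ℝ)) := by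
            have : 0 ≤ 1 + Real.log (q : ℝ) := hlog0.trans hlogle
            positivity
          calc _ ≤ (Nat.divisors q).card * ((2 * M + 1) * (g : ℝ) / q +
                (Nat.divisors q).card * Real.sqrt (q : ℝ) * (1 + Real.log (q : ℝ))) *
              (1 + 2 * Real.pi * |θ| / (((⌊M⌋₊ : ℤ) : ℝ) + 1)) := by
                gcongr ?_ * ?_ * _
                exact add_le_add hfirst hsecond
            _ ≤ _ := mul_le_mul_of_nonneg_left htwist (mul_nonneg hτ0 hsum0)

/-- **One `m`-sum of the diagonal, keeping the reduced modulus** (as `BC_diag_msum_le`, but with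
`q' = q/(c,q)` kept in the completed-sum term — needed for uniformity in the amplifier length `L`,
since for `ℓ₁ = ℓ₂ ∤ n₁` one has `q' ∣ bn₁`): for `ℓ₁n₁ = ℓ₂n₂`, `b, ℓ₁, n₁, n₂ ≥ 1`,
`M ≥ 1/2`, with `q = bℓ₁n₁`, `c = a₁ℓ₁ − a₂ℓ₂`, the sum over `M < m ≤ 2M`, `(m,b) = 1`,
`(ℓ₂n₂, m) = 1` of `e(⋯a₁⋯n₁⋯) conj e(⋯a₂⋯n₂⋯)` has norm `≤ 2M` if `c = 0`, and, if `c ≠ 0` and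
`(ϑ, q) = 1`, norm `≤ τ(q) ((2M+1)(c,q)/q + τ(q')√q'(1+log q')) (1 + 2π(|η||c|/q)/M)`.
[cite: BettinChandee2018, §3 (3.3)] -/
theorem BC_diag_msum_le' (ϑ : ℤ) (η : ℝ) (a₁ a₂ : ℕ) {b ℓ₁ n₁ ℓ₂ n₂ : ℕ} (hb : 0 < b)
    (hℓ₁ : 0 < ℓ₁) (hn₁ : 0 < n₁) (hn₂ : 0 < n₂) (hN : ℓ₁ * n₁ = ℓ₂ * n₂) {M : ℝ} (hM : 1 / 2 ≤ M) :
    let q : ℕ := b * (ℓ₁ * n₁)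
    let c : ℤ := ((a₁ * ℓ₁ : ℕ) : ℤ) - ((a₂ * ℓ₂ : ℕ) : ℤ)
    let S : ℂ := ∑ m ∈ (Ioc ⌊M⌋₊ ⌊2 * M⌋₊).filter (fun m => m.Coprime b),
      (if (ℓ₂ * n₂).Coprime m then
        Complex.exp (2 * Real.pi * Complex.I *
            ((ϑ : ℂ) * (a₁ : ℂ) * ((((m : ZMod (b * n₁))⁻¹).val : ℕ) : ℂ) / ((b * n₁ : ℕ) : ℂ) +
              (η : ℂ) * (a₁ : ℂ) / ((m : ℂ) * ((b * n₁ : ℕ) : ℂ)))) *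
          (starRingEnd ℂ) (Complex.exp (2 * Real.pi * Complex.I *
            ((ϑ : ℂ) * (a₂ : ℂ) * ((((m : ZMod (b * n₂))⁻¹).val : ℕ) : ℂ) / ((b * n₂ : ℕ) : ℂ) +
              (η : ℂ) * (a₂ : ℂ) / ((m : ℂ) * ((b * n₂ : ℕ) : ℂ)))))
        else 0)
    let q' : ℕ := q / Int.gcd c q
    (c ≠ 0 → (ϑ.natAbs).Coprime q →
      ‖S‖ ≤ (Nat.divisors q).card * ((2 * M + 1) * (Int.gcd c q) / q +
        (Nat.divisors q').card * Real.sqrt q' * (1 + Real.log q')) *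
        (1 + 2 * Real.pi * (|η| * |(c : ℝ)| / q) / M)) := by
  intro q c S q'
  have hM0 : 0 < M := by linarith
  have hq0 : 0 < q := Nat.mul_pos hb (Nat.mul_pos hℓ₁ hn₁)
  have hqeq : q = b * (ℓ₂ * n₂) := by show b * (ℓ₁ * n₁) = b * (ℓ₂ * n₂); rw [hN]
  set θ : ℝ := η * (((a₁ * ℓ₁ : ℕ) : ℝ) - ((a₂ * ℓ₂ : ℕ) : ℝ)) / ((b * (ℓ₁ * n₁) : ℕ) : ℝ) with hθ
  -- rewrite the sum as the twisted incomplete Kloosterman sum to modulus `q`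
  have hS : S = ∑ m ∈ (Ioc ⌊M⌋₊ ⌊2 * M⌋₊).filter (fun m => m.Coprime q),
      Complex.exp (2 * Real.pi * Complex.I *
          (((ϑ * c : ℤ) : ℂ) * ((((m : ZMod q)⁻¹).val : ℕ) : ℂ) / (q : ℂ))) *
        Complex.exp (2 * Real.pi * Complex.I * ((θ : ℂ) / (m : ℂ))) := by
    show (∑ m ∈ (Ioc ⌊M⌋₊ ⌊2 * M⌋₊).filter (fun m => m.Coprime b), _) = _
    rw [Finset.sum_filter, Finset.sum_filter]
    refine Finset.sum_congr rfl fun m hm => ?_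
    have hm0 : 0 < m := by have := (Finset.mem_Ioc.mp hm).1; omega
    by_cases hmb : m.Coprime b
    · rw [if_pos hmb]
      by_cases hml : (ℓ₂ * n₂).Coprime m
      · have hmq : m.Coprime q := by
          rw [hqeq]; exact Nat.Coprime.mul_right hmb hml.symm
        rw [if_pos hml, if_pos hmq]
        have hcop' : m.Coprime (b * (ℓ₁ * n₁)) := hmq
        rw [BC_diagE_mul_conj ϑ η a₁ a₂ hb hℓ₁ hn₁ hn₂ hm0 hN hcop']
      · have hmq : ¬ m.Coprime q := by
          intro h; apply hml
          rw [hqeq] at h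
          exact (Nat.Coprime.coprime_mul_left_right h).symm
        rw [if_neg hml, if_neg hmq]
    · have hmq : ¬ m.Coprime q := by
        intro h; apply hmb
        exact Nat.Coprime.coprime_mul_right_right (k := ℓ₁ * n₁) h
      rw [if_neg hmb, if_neg hmq]
  intro hc hϑq
  rw [hS]
  have h := BC_twisted_msum_sharp_le hq0 (ϑ * c) θ (M₁ := (⌊M⌋₊ : ℤ)) (M₂ := (⌊2 * M⌋₊ : ℤ))
    (by positivity) (by
      have : ⌊M⌋₊ ≤ ⌊2 * M⌋₊ := Nat.floor_le_floor (by linarith)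
      exact_mod_cast this)
  -- convert the integer-indexed sum to the natural-number one
  have hsum : ∑ x ∈ (Finset.Ioc (⌊M⌋₊ : ℤ) (⌊2 * M⌋₊ : ℤ)).filter (fun x : ℤ => Int.gcd x q = 1),
      Complex.exp (2 * Real.pi * Complex.I *
        (((ϑ * c : ℤ) : ℂ) * ((((x : ZMod q)⁻¹).val : ℕ) : ℂ) / (q : ℂ))) *
      Complex.exp (2 * Real.pi * Complex.I * ((θ : ℂ) / (x : ℂ))) =
    ∑ m ∈ (Ioc ⌊M⌋₊ ⌊2 * M⌋₊).filter (fun m => m.Coprime q),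
      Complex.exp (2 * Real.pi * Complex.I *
        (((ϑ * c : ℤ) : ℂ) * ((((m : ZMod q)⁻¹).val : ℕ) : ℂ) / (q : ℂ))) *
      Complex.exp (2 * Real.pi * Complex.I * ((θ : ℂ) / (m : ℂ))) := by
    refine Finset.sum_nbij' (fun y => y.toNat) (fun m => (m : ℤ)) ?_ ?_ ?_ ?_ ?_
    · intro y hy
      simp only [Finset.mem_filter, Finset.mem_Ioc] at hy ⊢
      obtain ⟨⟨h1, h2⟩, h3⟩ := hy
      refine ⟨⟨by omega, by omega⟩, ?_⟩
      rw [Nat.Coprime, ← h3, Int.gcd_eq_natAbs, Int.natAbs_natCast]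
      congr 1; omega
    · intro m hm
      simp only [Finset.mem_filter, Finset.mem_Ioc] at hm ⊢
      obtain ⟨⟨h1, h2⟩, h3⟩ := hm
      refine ⟨⟨by omega, by omega⟩, ?_⟩
      rw [Int.gcd_eq_natAbs, Int.natAbs_natCast, Int.natAbs_natCast]
      exact h3
    · intro y hy
      simp only [Finset.mem_filter, Finset.mem_Ioc] at hy
      exact Int.toNat_of_nonneg (by omega)
    · intro m _; simp
    · intro y hy
      simp only [Finset.mem_filter, Finset.mem_Ioc] at hy
      have hy0 : 0 ≤ y := by omega
      have hc' : ((y.toNat : ℕ) : ℤ) = y := Int.toNat_of_nonneg hy0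
      have hz : ((y.toNat : ℕ) : ZMod q) = ((y : ℤ) : ZMod q) := by rw [← Int.cast_natCast, hc']
      have hcC : ((y.toNat : ℕ) : ℂ) = ((y : ℤ) : ℂ) := by exact_mod_cast hc'
      rw [hz, hcC]
  rw [hsum] at h
  refine h.trans ?_
  -- simplify: `(ϑc, q) = (c, q)`, `q' = q/(c,q)`, `τ(q') ≤ τ(q)`, `q' ≤ q`, `⌊2M⌋-⌊M⌋+1 ≤ 2M+1`,
  -- `⌊M⌋ + 1 ≥ M`
  have hgcd : Int.gcd (ϑ * c) q = Int.gcd c q := by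
    rw [Int.gcd_eq_natAbs, Int.natAbs_mul, Int.natAbs_natCast, Int.gcd_eq_natAbs, Int.natAbs_natCast]
    exact Nat.Coprime.gcd_mul_left_cancel _ hϑq
  rw [hgcd]
  set g : ℕ := Int.gcd c q with hg
  have hg0 : 0 < g := by rw [hg]; exact Int.gcd_pos_of_ne_zero_left _ hc
  have hgq : g ∣ q := by rw [hg]; exact_mod_cast Int.gcd_dvd_right c q
  have hq'def : q' = q / g := rfl
  have hq'0 : 0 < q' := by rw [hq'def]; exact Nat.div_pos (Nat.le_of_dvd hq0 hgq) hg0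
  have hq'q : q' ∣ q := by rw [hq'def]; exact Nat.div_dvd_of_dvd hgq
  have hq'le : q' ≤ q := by rw [hq'def]; exact Nat.div_le_self _ _
  have hqr : (0 : ℝ) < q := by exact_mod_cast hq0
  have hq'r : (0 : ℝ) < q' := by exact_mod_cast hq'0
  have hlog0 : 0 ≤ 1 + Real.log (q' : ℝ) := by
    have := Real.log_nonneg (show (1 : ℝ) ≤ q' by exact_mod_cast hq'0); linarith
  have hinv : 1 / (q' : ℝ) = (g : ℝ) / q := by
    have hmul : (q' : ℝ) * g = q := by rw [hq'def]; exact_mod_cast Nat.div_mul_cancel hgq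
    field_simp; linarith
  have hlen : (((⌊2 * M⌋₊ : ℤ) - (⌊M⌋₊ : ℤ) : ℤ) : ℝ) + 1 ≤ 2 * M + 1 := by
    push_cast
    have h1 : ((⌊2 * M⌋₊ : ℕ) : ℝ) ≤ 2 * M := Nat.floor_le (by linarith)
    have h2 : (0 : ℝ) ≤ ((⌊M⌋₊ : ℕ) : ℝ) := Nat.cast_nonneg _
    linarith
  have hM1 : M ≤ ((⌊M⌋₊ : ℤ) : ℝ) + 1 := by
    have := Nat.lt_floor_add_one M; push_cast; exact_mod_cast this.le
  have htwist : 1 + 2 * Real.pi * |θ| / (((⌊M⌋₊ : ℤ) : ℝ) + 1) ≤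
      1 + 2 * Real.pi * (|η| * |(c : ℝ)| / q) / M := by
    have hθc : θ = η * (c : ℝ) / (q : ℝ) := by
      rw [hθ]
      show _ = η * (((((a₁ * ℓ₁ : ℕ) : ℤ) - ((a₂ * ℓ₂ : ℕ) : ℤ) : ℤ)) : ℝ) / ((b * (ℓ₁ * n₁) : ℕ) : ℝ)
      push_cast; ring
    have hθabs : |θ| = |η| * |(c : ℝ)| / q := by
      rw [hθc, abs_div, abs_mul, abs_of_pos hqr]
    rw [hθabs]
    have hnum : 0 ≤ 2 * Real.pi * (|η| * |(c : ℝ)| / q) := by positivity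
    have := div_le_div_of_nonneg_left hnum hM0 hM1
    linarith
  have htw0 : 0 ≤ 1 + 2 * Real.pi * |θ| / (((⌊M⌋₊ : ℤ) : ℝ) + 1) := by positivity
  have hτ0 : (0 : ℝ) ≤ (Nat.divisors q).card := Nat.cast_nonneg _
  calc (Nat.divisors q).card *
        (((((⌊2 * M⌋₊ : ℤ) - (⌊M⌋₊ : ℤ) : ℤ) : ℝ) + 1) / (q' : ℝ) +
          (Nat.divisors q').card * Real.sqrt (q' : ℝ) * (1 + Real.log (q' : ℝ))) *
        (1 + 2 * Real.pi * |θ| / (((⌊M⌋₊ : ℤ) : ℝ) + 1))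
      ≤ (Nat.divisors q).card * ((2 * M + 1) * (g : ℝ) / q +
          (Nat.divisors q').card * Real.sqrt (q' : ℝ) * (1 + Real.log (q' : ℝ))) *
        (1 + 2 * Real.pi * (|η| * |(c : ℝ)| / q) / M) := by
        have hfirst : ((((⌊2 * M⌋₊ : ℤ) - (⌊M⌋₊ : ℤ) : ℤ) : ℝ) + 1) / (q' : ℝ) ≤
            (2 * M + 1) * (g : ℝ) / q := by
          have e : ((((⌊2 * M⌋₊ : ℤ) - (⌊M⌋₊ : ℤ) : ℤ) : ℝ) + 1) / (q' : ℝ) =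
              ((((⌊2 * M⌋₊ : ℤ) - (⌊M⌋₊ : ℤ) : ℤ) : ℝ) + 1) * ((g : ℝ) / q) := by
            rw [← hinv]; ring
          rw [e, mul_div_assoc]
          exact mul_le_mul_of_nonneg_right hlen (by positivity)
        have hsum0 : 0 ≤ (2 * M + 1) * (g : ℝ) / q +
            (Nat.divisors q').card * Real.sqrt (q' : ℝ) * (1 + Real.log (q' : ℝ)) := by
          positivity
        calc _ ≤ (Nat.divisors q).card * ((2 * M + 1) * (g : ℝ) / q +
              (Nat.divisors q').card * Real.sqrt (q' : ℝ) * (1 + Real.log (q' : ℝ))) *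
            (1 + 2 * Real.pi * |θ| / (((⌊M⌋₊ : ℤ) : ℝ) + 1)) := by
              gcongr ?_ * ?_ * _
              exact add_le_add hfirst le_rfl
          _ ≤ _ := mul_le_mul_of_nonneg_left htwist (mul_nonneg hτ0 hsum0)

end Literature.NumberTheory.LFunctions

end
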